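import Summits.CriticalPhenomena.CardyFormulaZ2.Theorems.CardyMagicRigidityNestingRigidityTomographySwitchReduction
import Summits.CriticalPhenomena.CardyFormulaZ2.Theorems.CardyMagicRigidityNestingRigidityExteriorKeyhole
import HarnessLib

/-!
# The switch-planarity instance `TSwitchPlanar` holds

Crux `Summit.CriticalPhenomena.CardyFormulaZ2.Theses.CardyMagicRigidity.NestingRigidity` (stmt-CriticalPhenomena-4835),
line `pinch-resampling` v4, stub S10' `stub_neckTomographyV4`.  The PLANAR CORE of `TSwitchPlanar` — the displayed
hypothesis of `tSwitchPlanar_of_core` (`…NestingRigidityTomographySwitchReduction`, p166124) — is proved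
(`tSwitchPlanar_core`), whence the registered anchor `tSwitchPlanar_holds : TSwitchPlanar`.

THE CORE.  On the clean collar `TPinch x x s s`, two open crossings `v₁, v₂` of `Λ_{2s}(x) ∖ Λ_s(x)` in distinct open
collar-clusters and two closed crossings `w₁, w₂` in distinct closed collar-clusters are never joined by, respectively,
a `𝕋`-path of a set `P` and a `𝕋`-path of a set `Q` with `P ∩ Q = ∅`, both avoiding the hole `Λ_s(x)`, `P` open
and `Q` closed inside `Λ_{2s}(x)`.

PROOF (at the origin, `n = s + 1`, `N = 2s`; `s ≥ 2` since `TPinch x x 0 0 = TPinch x x 1 1 = ∅`).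
* Recolour: `ω⋆ = (Λ_N ∩ ω) ∪ (P ∖ Λ_N)`; the `P`-path is `ω⋆`-open, the `Q`-path and all closed collar paths are
  `ω⋆`-closed, all off the hole `{|·| < n}`.
* Frontier chains (`exists_frontierChains_alternating_of_lt`, p164150) of the open collar-cluster of `a = v₁ - x`
  facing `g = v₂ - x`: closed collar crossings `σ₁ ⇝ τ₁`, `σ₂ ⇝ τ₂`, not joined by a closed collar path, with
  `τ₁ < t_g < τ₂ < t_a` anticlockwise on `∂Λ_N`.  By "two of three closed crossings are joined" (`TPinch`) the pairs
  `{σ₁, σ₂}` and `{w₁ - x, w₂ - x}` match up through closed collar paths, so `σ₁ ⇝ σ₂` is `ω⋆`-closed off the hole.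
* Let `𝒪 ∋ a, g, t_a, t_g` and `𝒞 ∋ σ₁, σ₂, τ₁, τ₂` be the open/closed clusters of `a`/`σ₁` off the hole (inside a
  large hexagon).  If `𝒪` reaches at least as far out as `𝒞`, the KEYHOLE LEMMA (`keyhole_not_joined`,
  `…NestingRigidityExteriorKeyhole`) applied to the obstacle `𝒪` (plus one outward site) and the `𝒞`-path `σ₁ ⇝ σ₂`
  yields a ring path `σ₁ ⇝ σ₂` on `∂Λ_n` avoiding `𝒪`; then `τ₁ ⇝ σ₁ ⇝ σ₂ ⇝ τ₂` (off `𝒪` and off the hole) and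
  `t_g ⇝ g → hole → a ⇝ t_a` (inside `𝒪 ∪ hole`) are interleaved paths of the hexagon `Λ_N`:
  `triBall_not_interleaved_shift`.  Otherwise apply the keyhole lemma to the obstacle `𝒞` and the `𝒪`-path `a ⇝ g`:
  a ring path `g ⇝ a` avoiding `𝒞` gives `t_g ⇝ g ⇝ a ⇝ t_a` off `𝒞 ∪ hole` against `τ₁ ⇝ σ₁ → hole → σ₂ ⇝ τ₂`.

Sorry-free; no `Prop` definition is introduced or used as a hypothesis.
-/

noncomputable section

namespace Summit.CriticalPhenomena.CardyFormulaZ2.Cruxes.NestingRigidity.PinchResampling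

open Summit.CriticalPhenomena.CardyFormulaZ2.Theses.CardyMagicRigidity
open Set Literature.Probability.Percolation Literature.Probability.LatticeModels

/-! ## §1 Two path lemmas -/

section Paths

/-- **A path from a reachable site stays in the reachable set**: if `u` is reachable from `a` inside `Y ⊇ X`, a path
of `X` from `u` runs inside `X ∩ {reachable from a inside Y}`. -/
theorem pathIn_inter_reach {X Y : Set (Site 2)} {a u v : Site 2} (hXY : X ⊆ Y) (hu : PathIn triGraph Y a u)
    (h : PathIn triGraph X u v) : PathIn triGraph (X ∩ {w | PathIn triGraph Y a w}) u v :=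
  h.to_reach.mono fun w hw ↦
    ⟨(show PathIn triGraph X u w from hw).right_mem, hu.trans ((show PathIn triGraph X u w from hw).mono hXY)⟩

/-- **The farthest site of a bounded reachable set, and one step beyond**: for `R = {reachable from a inside Y}` with
`Y ⊆ Λ_K`, a site `z⁺ ∉ Λ_m` adjacent to `R`, where `m` bounds the norms on `R`, with `|z⁺| = m + 1`. -/
theorem exists_top_of_reach {Y : Set (Site 2)} {a : Site 2} {K : ℕ} (hY : ∀ v ∈ Y, triNorm v ≤ K) (ha : a ∈ Y) :
    ∃ (m : ℕ) (z₀ z : Site 2), PathIn triGraph Y a z₀ ∧ triNorm z₀ = m ∧ triGraph.Adj z₀ z ∧ triNorm z = m + 1 ∧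
      ∀ v, PathIn triGraph Y a v → triNorm v ≤ m := by
  classical
  set S := (triBall K).filter (fun v ↦ PathIn triGraph Y a v) with hS
  have memS : ∀ {v : Site 2}, v ∈ S ↔ PathIn triGraph Y a v := fun {v} ↦ by
    rw [hS, Finset.mem_filter, mem_triBall_iff]
    exact ⟨fun h ↦ h.2, fun h ↦ ⟨hY v h.right_mem, h⟩⟩
  obtain ⟨z₀, hz₀S, hmax⟩ := S.exists_max_image triNorm ⟨a, memS.2 (PathIn.refl ha)⟩
  obtain ⟨z, hadj, hz⟩ := exists_adj_triNorm_eq_add_one z₀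
  have h0 := triNorm_nonneg z₀
  refine ⟨(triNorm z₀).toNat, z₀, z, memS.1 hz₀S, by omega, hadj, by omega, fun v hv ↦ ?_⟩
  have := hmax v (memS.2 hv); omega

end Paths

/-! ## §2 The alternating configuration at the origin and its impossibility -/

section Origin

variable {s K : ℕ} {O : Set (Site 2)} {a g ta tg σ₁ σ₂ τ₁ τ₂ : Site 2}

/-- **The configuration at the origin is impossible.**  Data: `s ≥ 2`, a class `O` of sites ("open"); open collar
arms `a ⇝ t_a`, `g ⇝ t_g` and closed collar crossings `σ₁ ⇝ τ₁`, `σ₂ ⇝ τ₂` of `{s+1 ≤ |·| ≤ 2s}` with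
`0 < [t_g] < [τ₂] < [t_a]` anticlockwise from `τ₁` on `∂Λ_{2s}`; an open path `a ⇝ g` and a closed path `σ₁ ⇝ σ₂`
of `{s+1 ≤ |·| ≤ K}` (off the hole).  Conclusion: `False` — by the keyhole lemma applied to whichever of the two
exterior clusters reaches farther out, and `triBall_not_interleaved_shift` in `Λ_{2s}`. -/
theorem origin_false (hs : 2 ≤ s) (hK : 2 * s ≤ K)
    (ha : triNorm a = s + 1) (hg : triNorm g = s + 1) (hta : triNorm ta = 2 * s) (htg : triNorm tg = 2 * s)
    (hσ₁ : triNorm σ₁ = ↑(s + 1)) (hσ₂ : triNorm σ₂ = ↑(s + 1)) (hτ₁ : triNorm τ₁ = ↑(2 * s))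
    (hτ₂ : triNorm τ₂ = ↑(2 * s))
    (hA : PathIn triGraph (triAnn (s + 1) (2 * s) ∩ O) a ta) (hG : PathIn triGraph (triAnn (s + 1) (2 * s) ∩ O) g tg)
    (hC₁ : PathIn triGraph (triAnn (s + 1) (2 * s) \ O) σ₁ τ₁) (hC₂ : PathIn triGraph (triAnn (s + 1) (2 * s) \ O) σ₂ τ₂)
    (h0 : 0 < hexShift (2 * s) τ₁ tg) (h1 : hexShift (2 * s) τ₁ tg < hexShift (2 * s) τ₁ τ₂)
    (h2 : hexShift (2 * s) τ₁ τ₂ < hexShift (2 * s) τ₁ ta)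
    (hα : PathIn triGraph (triAnn (s + 1) K ∩ O) a g) (hβ : PathIn triGraph (triAnn (s + 1) K \ O) σ₁ σ₂) : False := by
  have hn : 1 ≤ s + 1 := by omega
  have hN : 1 ≤ 2 * s := by omega
  set n := s + 1 with hndef
  set N := 2 * s with hNdef
  -- the two exterior clusters
  set YO : Set (Site 2) := triAnn n K ∩ O with hYO
  set YC : Set (Site 2) := triAnn n K \ O with hYC
  have hYOK : ∀ v ∈ YO, triNorm v ≤ K := fun v hv ↦ (mem_triAnn.1 hv.1).2
  have hYCK : ∀ v ∈ YC, triNorm v ≤ K := fun v hv ↦ (mem_triAnn.1 hv.1).2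
  have subO : triAnn n N ∩ O ⊆ YO := fun v hv ↦ ⟨mem_triAnn.2 ⟨(mem_triAnn.1 hv.1).1, by
    have := (mem_triAnn.1 hv.1).2; omega⟩, hv.2⟩
  have subC : triAnn n N \ O ⊆ YC := fun v hv ↦ ⟨mem_triAnn.2 ⟨(mem_triAnn.1 hv.1).1, by
    have := (mem_triAnn.1 hv.1).2; omega⟩, hv.2⟩
  obtain ⟨mO, zO, zO', hzO, hzOm, hadjO, hzO'm, hmaxO⟩ := exists_top_of_reach hYOK hα.left_mem
  obtain ⟨mC, zC, zC', hzC, hzCm, hadjC, hzC'm, hmaxC⟩ := exists_top_of_reach hYCK hβ.left_mem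
  have hnmO : (n : ℤ) ≤ mO := by have := (mem_triAnn.1 hzO.right_mem.1).1; omega
  have hnmC : (n : ℤ) ≤ mC := by have := (mem_triAnn.1 hzC.right_mem.1).1; omega
  -- hexagon bookkeeping
  have ballA : ∀ {v : Site 2}, v ∈ triAnn n N → v ∈ (↑(triBall N) : Set (Site 2)) := fun hv ↦
    Finset.mem_coe.2 (mem_triBall_iff.2 (mem_triAnn.1 hv).2)
  have ballH : ∀ {v : Site 2}, triNorm v < n → v ∈ (↑(triBall N) : Set (Site 2)) := fun hv ↦
    Finset.mem_coe.2 (mem_triBall_iff.2 (by omega))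
  have ballR : ∀ {v : Site 2}, triNorm v = n → v ∈ (↑(triBall N) : Set (Site 2)) := fun hv ↦
    Finset.mem_coe.2 (mem_triBall_iff.2 (by omega))
  rcases le_total (mC : ℤ) mO with hle | hle
  · -- the open cluster reaches at least as far: obstacle `𝒪 ∪ {zO'}`
    set R : Set (Site 2) := {w | PathIn triGraph YO a w} with hR
    set B : Set (Site 2) := R ∪ {zO'} with hB
    have hRB : R ⊆ B := subset_union_left
    have hBsub : B ⊆ triAnn n (mO + 1) := by
      rintro v (hv | hv)
      · exact mem_triAnn.2 ⟨(mem_triAnn.1 (show PathIn triGraph YO a v from hv).right_mem.1).1, by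
          have := hmaxO v hv; push_cast; omega⟩
      · rw [mem_singleton_iff.1 hv]; exact mem_triAnn.2 ⟨by omega, by push_cast; omega⟩
    have hconn : ∀ v ∈ B, PathIn triGraph B a v := by
      rintro v (hv | hv)
      · exact (show PathIn triGraph YO a v from hv).to_reach.mono hRB
      · rw [mem_singleton_iff.1 hv]
        exact (hzO.to_reach.mono hRB).tail hadjO (Or.inr rfl)
    have hCpath : PathIn triGraph (triAnn n (mO + 1) \ B) σ₁ σ₂ := by
      refine hβ.to_reach.mono fun v hv ↦ ?_
      have hv' : PathIn triGraph YC σ₁ v := hv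
      have hvn := (mem_triAnn.1 hv'.right_mem.1).1
      have hvm := hmaxC v hv'
      refine ⟨mem_triAnn.2 ⟨hvn, by push_cast; omega⟩, ?_⟩
      rintro (h | h)
      · exact hv'.right_mem.2 (show PathIn triGraph YO a v from h).right_mem.2
      · rw [mem_singleton_iff.1 h] at hvm; omega
    have ring := keyhole_not_joined (n := n) (M := mO + 1) hn (by omega) hBsub hconn ha (Or.inr rfl)
      (by push_cast; exact hzO'm) hσ₁ hσ₂ hCpath
    -- interleaving in the hexagon: closed `τ₁ ⇝ σ₁ ⇝ σ₂ ⇝ τ₂` off `R ∪ hole`, open `t_g ⇝ g → hole → a ⇝ t_a` inside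
    set D : Set (Site 2) := (R ∪ {w | triNorm w < n})ᶜ with hD
    have hP : PathIn triGraph ((↑(triBall N) : Set (Site 2)) ∩ D) τ₁ τ₂ := by
      have c : ∀ {u v : Site 2}, PathIn triGraph (triAnn n N \ O) u v →
          PathIn triGraph ((↑(triBall N) : Set (Site 2)) ∩ D) u v := fun hp ↦
        hp.mono fun w hw ↦ ⟨ballA hw.1, fun h ↦ h.elim
          (fun h ↦ hw.2 (show PathIn triGraph YO a w from h).right_mem.2)
          (fun h ↦ by have := (mem_triAnn.1 hw.1).1; have : triNorm w < n := h; omega)⟩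
      have r : PathIn triGraph ((↑(triBall N) : Set (Site 2)) ∩ D) σ₁ σ₂ :=
        ring.mono fun w hw ↦ ⟨ballR hw.1, fun h ↦ h.elim (fun h ↦ hw.2 (hRB h))
          (fun h ↦ by have : triNorm w = n := hw.1; have : triNorm w < n := h; omega)⟩
      exact ((c hC₁).symm.trans r).trans (c hC₂)
    have hQ : PathIn triGraph ((↑(triBall N) : Set (Site 2)) ∩ Dᶜ) tg ta := by
      rw [hD, compl_compl]
      have arm : ∀ {u v : Site 2}, PathIn triGraph YO a u → PathIn triGraph (triAnn n N ∩ O) u v →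
          PathIn triGraph ((↑(triBall N) : Set (Site 2)) ∩ (R ∪ {w | triNorm w < n})) u v := fun hu hp ↦
        (pathIn_inter_reach subO hu hp).mono fun w hw ↦ ⟨ballA hw.1.1, Or.inl hw.2⟩
      have hole : PathIn triGraph ((↑(triBall N) : Set (Site 2)) ∩ (R ∪ {w | triNorm w < n})) g a :=
        (pathIn_through_hole hn hg ha).mono fun w hw ↦ hw.elim (fun h ↦ ⟨ballH h, Or.inr h⟩) fun h ↦ by
          rcases h with rfl | rfl
          · exact ⟨ballR hg, Or.inl hα⟩
          · exact ⟨ballR ha, Or.inl (PathIn.refl hα.left_mem)⟩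
      exact ((arm hα hG).symm.trans hole).trans (arm (PathIn.refl hα.left_mem) hA)
    exact triBall_not_interleaved_shift hN D hτ₁ hτ₁ htg hτ₂ hta (by rw [hexShift_self]; exact h0) h1 h2 hP hQ
  · -- the closed cluster reaches at least as far: obstacle `𝒞 ∪ {zC'}`
    set R : Set (Site 2) := {w | PathIn triGraph YC σ₁ w} with hR
    set B : Set (Site 2) := R ∪ {zC'} with hB
    have hRB : R ⊆ B := subset_union_left
    have hBsub : B ⊆ triAnn n (mC + 1) := by
      rintro v (hv | hv)
      · exact mem_triAnn.2 ⟨(mem_triAnn.1 (show PathIn triGraph YC σ₁ v from hv).right_mem.1).1, by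
          have := hmaxC v hv; push_cast; omega⟩
      · rw [mem_singleton_iff.1 hv]; exact mem_triAnn.2 ⟨by omega, by push_cast; omega⟩
    have hconn : ∀ v ∈ B, PathIn triGraph B σ₁ v := by
      rintro v (hv | hv)
      · exact (show PathIn triGraph YC σ₁ v from hv).to_reach.mono hRB
      · rw [mem_singleton_iff.1 hv]
        exact (hzC.to_reach.mono hRB).tail hadjC (Or.inr rfl)
    have hOpath : PathIn triGraph (triAnn n (mC + 1) \ B) a g := by
      refine hα.to_reach.mono fun v hv ↦ ?_
      have hv' : PathIn triGraph YO a v := hv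
      have hvn := (mem_triAnn.1 hv'.right_mem.1).1
      have hvm := hmaxO v hv'
      refine ⟨mem_triAnn.2 ⟨hvn, by push_cast; omega⟩, ?_⟩
      rintro (h | h)
      · exact (show PathIn triGraph YC σ₁ v from h).right_mem.2 hv'.right_mem.2
      · rw [mem_singleton_iff.1 h] at hvm; omega
    have ring := keyhole_not_joined (n := n) (M := mC + 1) hn (by omega) hBsub hconn hσ₁ (Or.inr rfl)
      (by push_cast; exact hzC'm) ha hg hOpath
    -- interleaving in the hexagon: closed `τ₁ ⇝ σ₁ → hole → σ₂ ⇝ τ₂` inside `R ∪ hole`, open `t_g ⇝ g ⇝ a ⇝ t_a` off it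
    set D : Set (Site 2) := R ∪ {w | triNorm w < n} with hD
    have hP : PathIn triGraph ((↑(triBall N) : Set (Site 2)) ∩ D) τ₁ τ₂ := by
      have arm : ∀ {u v : Site 2}, PathIn triGraph YC σ₁ u → PathIn triGraph (triAnn n N \ O) u v →
          PathIn triGraph ((↑(triBall N) : Set (Site 2)) ∩ D) u v := fun hu hp ↦
        (pathIn_inter_reach subC hu hp).mono fun w hw ↦ ⟨ballA hw.1.1, Or.inl hw.2⟩
      have hole : PathIn triGraph ((↑(triBall N) : Set (Site 2)) ∩ D) σ₁ σ₂ :=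
        (pathIn_through_hole hn hσ₁ hσ₂).mono fun w hw ↦ hw.elim (fun h ↦ ⟨ballH h, Or.inr h⟩) fun h ↦ by
          rcases h with rfl | rfl
          · exact ⟨ballR hσ₁, Or.inl (PathIn.refl hβ.left_mem)⟩
          · exact ⟨ballR hσ₂, Or.inl hβ⟩
      exact ((arm (PathIn.refl hβ.left_mem) hC₁).symm.trans hole).trans (arm hβ hC₂)
    have hQ : PathIn triGraph ((↑(triBall N) : Set (Site 2)) ∩ Dᶜ) tg ta := by
      have c : ∀ {u v : Site 2}, PathIn triGraph (triAnn n N ∩ O) u v →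
          PathIn triGraph ((↑(triBall N) : Set (Site 2)) ∩ Dᶜ) u v := fun hp ↦
        hp.mono fun w hw ↦ ⟨ballA hw.1, fun h ↦ h.elim
          (fun h ↦ (show PathIn triGraph YC σ₁ w from h).right_mem.2 hw.2)
          (fun h ↦ by have := (mem_triAnn.1 hw.1).1; have : triNorm w < n := h; omega)⟩
      have r : PathIn triGraph ((↑(triBall N) : Set (Site 2)) ∩ Dᶜ) g a :=
        ring.symm.mono fun w hw ↦ ⟨ballR hw.1, fun h ↦ h.elim (fun h ↦ hw.2 (hRB h))
          (fun h ↦ by have : triNorm w = n := hw.1; have : triNorm w < n := h; omega)⟩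
      exact ((c hG).symm.trans r).trans (c hA)
    exact triBall_not_interleaved_shift hN D hτ₁ hτ₁ htg hτ₂ hta (by rw [hexShift_self]; exact h0) h1 h2 hP hQ

end Origin

/-! ## §3 The planar core at centre `x` and the registered anchor -/

section Core

/-- **The planar core of `TSwitchPlanar`** (the displayed hypothesis of `tSwitchPlanar_of_core`): on `TPinch x x s s`,
two open crossings in distinct open collar-clusters and two closed crossings in distinct closed collar-clusters are
not joined by `𝕋`-paths of disjoint sets `P`, `Q` avoiding the hole, `P` open and `Q` closed inside `Λ_{2s}(x)`. -/
theorem tSwitchPlanar_core (ω : SiteConfig (Site 2)) (x : Site 2) (s : ℕ) (P Q : Set (Site 2)) (v₁ v₂ w₁ w₂ : Site 2)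
    (hpinch : ω ∈ TPinch x x s s) (hPQ : Disjoint P Q) (hPI : Disjoint P (tBall x s)) (hQI : Disjoint Q (tBall x s))
    (hPO : P ∩ tBall x (2 * s) ⊆ {u | (u ∈ ω) = true}) (hQC : Q ∩ tBall x (2 * s) ⊆ {u | (u ∈ ω) = false})
    (hv₁ : IsCrossing triGraph (tColourGraph ω true) (tBall x s) (tBall x (2 * s)) v₁)
    (hv₂ : IsCrossing triGraph (tColourGraph ω true) (tBall x s) (tBall x (2 * s)) v₂)
    (hnv : ¬ PathIn (tColourGraph ω true) (tBall x (2 * s) \ tBall x s) v₁ v₂)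
    (hw₁ : IsCrossing triGraph (tColourGraph ω false) (tBall x s) (tBall x (2 * s)) w₁)
    (hw₂ : IsCrossing triGraph (tColourGraph ω false) (tBall x s) (tBall x (2 * s)) w₂)
    (hnw : ¬ PathIn (tColourGraph ω false) (tBall x (2 * s) \ tBall x s) w₁ w₂)
    (hP : PathIn triGraph P v₁ v₂) (hQ : PathIn triGraph Q w₁ w₂) : False := by
  rcases Nat.lt_or_ge s 2 with hs | hs
  · interval_cases s
    · rw [tPinch_eq_empty_of_zero (by simp)] at hpinch; exact hpinch
    · rw [tPinch_one_eq_empty] at hpinch; exact hpinch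
  have hfa : TFourArms ω (tBall x s) (tBall x (2 * s)) := hpinch
  obtain ⟨-, -, h23⟩ := hfa
  set ω₀ : Set (Site 2) := {z | z + x ∈ ω} with hω₀
  have hn : 1 ≤ s + 1 := by omega
  have hnN : s + 1 < 2 * s := by omega
  have hift : ∀ c : Bool, {z : Site 2 | z + x ∈ (if c then ω else ωᶜ)} = (if c then ω₀ else ω₀ᶜ) := by
    intro c; cases c
    · exact shift_compl x ω
    · rfl
  -- the open arms and their separation in the collar
  obtain ⟨han, hacol, ta, hta, hA⟩ := exists_pathIn_of_isCrossing hs hv₁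
  obtain ⟨hgn, -, tg, htg, hG⟩ := exists_pathIn_of_isCrossing hs hv₂
  rw [hift] at hA hG
  simp only [↓reduceIte] at hA hG
  have hsepA : ¬ PathIn triGraph (triAnn (s + 1) (2 * s) ∩ ω₀) (v₁ - x) (v₂ - x) := by
    intro h
    refine hnv ((pathIn_collar_iff hacol).2 ?_)
    rw [hift]; simpa using h
  -- the frontier chains
  obtain ⟨F, hF, h0, h1, h2⟩ := exists_frontierChains_alternating_of_lt hn hnN hA han hta hG hgn htg hsepA
  have hch₁ : PathIn triGraph (triAnn (s + 1) (2 * s) \ ω₀) F.σ₁ F.τ₁ := F.chain₁.mono annFrontier_subset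
  have hch₂ : PathIn triGraph (triAnn (s + 1) (2 * s) \ ω₀) F.σ₂ F.τ₂ := (F.chain₂.mono annFrontier_subset).symm
  -- closed collar paths at centre `x`, read at the origin
  have readC : ∀ {u v : Site 2}, (u ∈ ω) = false →
      PathIn (tColourGraph ω false) (tBall x (2 * s) \ tBall x s) u v →
      PathIn triGraph (triAnn (s + 1) (2 * s) \ ω₀) (u - x) (v - x) := by
    intro u v hu h
    have := (pathIn_collar_iff hu).1 h
    rw [hift] at this
    simpa [Set.sdiff_eq] using this
  have hσ₁c : (F.σ₁ + x ∈ ω) = false := by have h : F.σ₁ + x ∉ ω := hch₁.left_mem.2; simp [h]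
  have hσ₂c : (F.σ₂ + x ∈ ω) = false := by have h : F.σ₂ + x ∉ ω := hch₂.left_mem.2; simp [h]
  have hS₁ : IsCrossing triGraph (tColourGraph ω false) (tBall x s) (tBall x (2 * s)) (F.σ₁ + x) :=
    isCrossing_of_pathIn (c := false) (by omega) F.norm_σ₁ F.norm_τ₁ (by rw [hift]; simpa [Set.sdiff_eq] using hch₁)
  have hS₂ : IsCrossing triGraph (tColourGraph ω false) (tBall x s) (tBall x (2 * s)) (F.σ₂ + x) :=
    isCrossing_of_pathIn (c := false) (by omega) F.norm_σ₂ F.norm_τ₂ (by rw [hift]; simpa [Set.sdiff_eq] using hch₂)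
  have hS₁₂ : ¬ PathIn (tColourGraph ω false) (tBall x (2 * s) \ tBall x s) (F.σ₁ + x) (F.σ₂ + x) := by
    intro h
    have := readC hσ₁c h
    simp only [add_sub_cancel_right] at this
    exact hF ((hch₁.symm.trans this).trans hch₂)
  -- the recoloured configuration `ω⋆` and the exterior classes
  set ball : Set (Site 2) := (↑(triBall (2 * s)) : Set (Site 2)) with hball
  set O : Set (Site 2) := (ball ∩ ω₀) ∪ ({z | z + x ∈ P} \ ball) with hO
  have collO : triAnn (s + 1) (2 * s) ∩ ω₀ ⊆ triAnn (s + 1) (2 * s) ∩ O := fun v hv ↦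
    ⟨hv.1, Or.inl ⟨Finset.mem_coe.2 (mem_triBall_iff.2 (mem_triAnn.1 hv.1).2), hv.2⟩⟩
  have collC : triAnn (s + 1) (2 * s) \ ω₀ ⊆ triAnn (s + 1) (2 * s) \ O := fun v hv ↦
    ⟨hv.1, fun h ↦ h.elim (fun h ↦ hv.2 h.2) fun h ↦ h.2 (Finset.mem_coe.2 (mem_triBall_iff.2 (mem_triAnn.1 hv.1).2))⟩
  have normP : ∀ {z : Site 2}, z + x ∈ P → (↑(s + 1) : ℤ) ≤ triNorm z := fun {z} hz ↦ by
    have h : z + x ∉ tBall x s := Set.disjoint_left.1 hPI hz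
    simp only [tBall, mem_setOf_eq, add_sub_cancel_right, not_le] at h
    push_cast; omega
  have normQ : ∀ {z : Site 2}, z + x ∈ Q → (↑(s + 1) : ℤ) ≤ triNorm z := fun {z} hz ↦ by
    have h : z + x ∉ tBall x s := Set.disjoint_left.1 hQI hz
    simp only [tBall, mem_setOf_eq, add_sub_cancel_right, not_le] at h
    push_cast; omega
  have memP : ∀ {z : Site 2}, z + x ∈ P → z ∈ O := fun {z} hz ↦ by
    by_cases hb : z ∈ ball
    · refine Or.inl ⟨hb, ?_⟩
      have h2 : z + x ∈ tBall x (2 * s) := by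
        have := mem_triBall_iff.1 (Finset.mem_coe.1 hb)
        simp only [tBall, mem_setOf_eq, add_sub_cancel_right]; exact this
      have := hPO ⟨hz, h2⟩
      show z + x ∈ ω
      simpa using this
    · exact Or.inr ⟨hz, hb⟩
  have memQ : ∀ {z : Site 2}, z + x ∈ Q → z ∉ O := fun {z} hz h ↦ by
    rcases h with ⟨hb, hzω⟩ | ⟨hzP, -⟩
    · have h2 : z + x ∈ tBall x (2 * s) := by
        have := mem_triBall_iff.1 (Finset.mem_coe.1 hb)
        simp only [tBall, mem_setOf_eq, add_sub_cancel_right]; exact this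
      have := hQC ⟨hz, h2⟩
      have hzω' : z + x ∈ ω := hzω
      simp [hzω'] at this
    · exact Set.disjoint_left.1 hPQ hzP hz
  -- the exterior open path `a ⇝ g` and closed path `σ₁ ⇝ σ₂`, bounded
  have hαE : PathIn triGraph ({z | (↑(s + 1) : ℤ) ≤ triNorm z} ∩ O) (v₁ - x) (v₂ - x) :=
    ((pathIn_triGraph_shift_iff x P v₁ v₂).1 hP).mono fun z hz ↦ ⟨normP hz, memP hz⟩
  have hβQ : PathIn triGraph ({z | (↑(s + 1) : ℤ) ≤ triNorm z} \ O) (w₁ - x) (w₂ - x) :=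
    ((pathIn_triGraph_shift_iff x Q w₁ w₂).1 hQ).mono fun z hz ↦ ⟨normQ hz, memQ hz⟩
  have liftC : ∀ {u v : Site 2}, PathIn triGraph (triAnn (s + 1) (2 * s) \ ω₀) u v →
      PathIn triGraph ({z | (↑(s + 1) : ℤ) ≤ triNorm z} \ O) u v := fun hp ↦
    (hp.mono collC).mono fun z hz ↦ ⟨(mem_triAnn.1 hz.1).1, hz.2⟩
  have hβE : PathIn triGraph ({z | (↑(s + 1) : ℤ) ≤ triNorm z} \ O) F.σ₁ F.σ₂ := by
    have j₁ : ∀ {w : Site 2}, PathIn (tColourGraph ω false) (tBall x (2 * s) \ tBall x s) (F.σ₁ + x) w →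
        PathIn triGraph ({z | (↑(s + 1) : ℤ) ≤ triNorm z} \ O) F.σ₁ (w - x) := fun h ↦ by
      simpa using liftC (readC hσ₁c h)
    have j₂ : ∀ {w : Site 2}, PathIn (tColourGraph ω false) (tBall x (2 * s) \ tBall x s) (F.σ₂ + x) w →
        PathIn triGraph ({z | (↑(s + 1) : ℤ) ≤ triNorm z} \ O) F.σ₂ (w - x) := fun h ↦ by
      simpa using liftC (readC hσ₂c h)
    rcases h23 _ _ _ hS₁ hS₂ hw₁ with h | h₁ | h₁
    · exact absurd h hS₁₂
    · rcases h23 _ _ _ hS₁ hS₂ hw₂ with h | h₂ | h₂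
      · exact absurd h hS₁₂
      · exact absurd (h₁.symm.trans h₂) hnw
      · exact ((j₁ h₁).trans hβQ).trans (j₂ h₂).symm
    · rcases h23 _ _ _ hS₁ hS₂ hw₂ with h | h₂ | h₂
      · exact absurd h hS₁₂
      · exact ((j₁ h₂).trans hβQ.symm).trans (j₂ h₁).symm
      · exact absurd (h₁.symm.trans h₂) hnw
  obtain ⟨K₁, hK₁⟩ := hαE.exists_norm_le
  obtain ⟨K₂, hK₂⟩ := hβE.exists_norm_le
  set K := max (max K₁ K₂) (2 * s) with hKdef
  have hα : PathIn triGraph (triAnn (s + 1) K ∩ O) (v₁ - x) (v₂ - x) :=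
    hK₁.mono fun z hz ↦ ⟨mem_triAnn.2 ⟨hz.1.1, by have : triNorm z ≤ K₁ := hz.2; omega⟩, hz.1.2⟩
  have hβ : PathIn triGraph (triAnn (s + 1) K \ O) F.σ₁ F.σ₂ :=
    hK₂.mono fun z hz ↦ ⟨mem_triAnn.2 ⟨hz.1.1, by have : triNorm z ≤ K₂ := hz.2; omega⟩, hz.1.2⟩
  exact origin_false hs (by omega) han hgn hta htg F.norm_σ₁ F.norm_σ₂ F.norm_τ₁ F.norm_τ₂
    (hA.mono collO) (hG.mono collO) (hch₁.mono collC) (hch₂.mono collC) h0 h1 h2 hα hβ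

/-- **Registered anchor: the switch-planarity instance `TSwitchPlanar` holds** — `tSwitchPlanar_of_core` applied to
the planar core `tSwitchPlanar_core`. -/
theorem tSwitchPlanar_holds : TSwitchPlanar :=
  tSwitchPlanar_of_core tSwitchPlanar_core

end Core

end Summit.CriticalPhenomena.CardyFormulaZ2.Cruxes.NestingRigidity.PinchResampling

end
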